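import Mathlib
import Summits.Ventures.HodgeRepro.Tier4.Line1.AdicIntegersCompact

/-!
# Tier4/Line1/AdeleCocompactAssembly — rung C3 of the R-c cut: `𝔸_k/k` is compact, from C1 + C2

Blind re-derivation cell `pub-hodge-repro`, Tier 4 (README §9–§10), seat t4-L1-p5 (prover, LINE L1, gen 0).
The cut of the cocompactness wall (S12723, proofs/t4-L1-p5/I1c-rungs-sig.lean): (C1) `𝔸_{k,f} = k + ∏_v 𝓞_v`
(t4-L1-p1) and (C2) `𝔸_{k,∞} = 𝓞_k + C_∞` with `C_∞` compact (t4-L3-p2) give (C3) «`𝔸_k/k` is compact»: a compact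
`C = C_∞ × ∏_v 𝓞_v` with `k + C = 𝔸_k` — `∏_v 𝓞_v` is compact in the finite adele ring as the image of the compact
product (Tychonoff with `compactSpace_adicCompletionIntegers`) under the continuous structure map.  Stated here with
C1 and C2 as DISPLAYED hypotheses, so that it becomes C3 by name the moment they land.

Nothing here says anything about the status of the Hodge conjecture for CM abelian varieties, which is NOT proved
(HC_CM is NOT proved by anyone in this repository).
-/

set_option autoImplicit false

noncomputable section

namespace Summit.Ventures.HodgeRepro.Tier4.Line1

open NumberField IsDedekindDomain HeightOneSpectrum Topology
open scoped RestrictedProduct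

section Assembly

variable (k : Type) [Field k] [NumberField k]

/-- The integral finite adeles `∏_v 𝓞_v` form a COMPACT subset of `𝔸_{k,f}`. -/
theorem isCompact_integralFiniteAdeles :
    IsCompact {a : FiniteAdeleRing (𝓞 k) k |
      ∀ v : HeightOneSpectrum (𝓞 k), a v ∈ v.adicCompletionIntegers k} := by
  haveI : ∀ v : HeightOneSpectrum (𝓞 k), CompactSpace (v.adicCompletionIntegers k) :=
    fun v => compactSpace_adicCompletionIntegers k v
  have hrange : {a : FiniteAdeleRing (𝓞 k) k |
      ∀ v : HeightOneSpectrum (𝓞 k), a v ∈ v.adicCompletionIntegers k} =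
      Set.range (RestrictedProduct.structureMap (fun w : HeightOneSpectrum (𝓞 k) => w.adicCompletion k)
        (fun w => (w.adicCompletionIntegers k : Set (w.adicCompletion k))) Filter.cofinite) := by
    rw [RestrictedProduct.range_structureMap]
    rfl
  rw [hrange]
  exact isCompact_range RestrictedProduct.isEmbedding_structureMap.continuous

/-- (C3 modulo C1, C2) **`𝔸_k/k` is compact**: from strong approximation (C1) and the archimedean lattice (C2). -/
theorem exists_compact_add_principal_of
    (h1 : ∀ x : FiniteAdeleRing (𝓞 k) k, ∃ a : k, ∀ v : HeightOneSpectrum (𝓞 k),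
      (x - algebraMap k (FiniteAdeleRing (𝓞 k) k) a) v ∈ v.adicCompletionIntegers k)
    (h2 : ∃ C : Set (InfiniteAdeleRing k), IsCompact C ∧
      ∀ x : InfiniteAdeleRing k, ∃ b : 𝓞 k, x - algebraMap k (InfiniteAdeleRing k) (b : k) ∈ C) :
    ∃ C : Set (AdeleRing (𝓞 k) k), IsCompact C ∧
      ∀ x : AdeleRing (𝓞 k) k, ∃ a : k, x - algebraMap k (AdeleRing (𝓞 k) k) a ∈ C := by
  obtain ⟨Cinf, hCinf, hcov⟩ := h2
  refine ⟨Cinf ×ˢ {a : FiniteAdeleRing (𝓞 k) k |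
      ∀ v : HeightOneSpectrum (𝓞 k), a v ∈ v.adicCompletionIntegers k},
    hCinf.prod (isCompact_integralFiniteAdeles k), ?_⟩
  intro x
  obtain ⟨a₁, ha₁⟩ := h1 x.2
  obtain ⟨b, hb⟩ := hcov (x.1 - algebraMap k (InfiniteAdeleRing k) a₁)
  refine ⟨a₁ + b, Set.mem_prod.2 ⟨?_, ?_⟩⟩
  · show x.1 - algebraMap k (InfiniteAdeleRing k) (a₁ + b) ∈ Cinf
    rw [map_add, ← sub_sub]
    exact hb
  · show ∀ v : HeightOneSpectrum (𝓞 k),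
      (x.2 - algebraMap k (FiniteAdeleRing (𝓞 k) k) (a₁ + b)) v ∈ v.adicCompletionIntegers k
    intro v
    rw [map_add, ← sub_sub]
    have e : (x.2 - algebraMap k (FiniteAdeleRing (𝓞 k) k) a₁ -
        algebraMap k (FiniteAdeleRing (𝓞 k) k) (b : k)) v =
        (x.2 - algebraMap k (FiniteAdeleRing (𝓞 k) k) a₁) v -
          (algebraMap k (FiniteAdeleRing (𝓞 k) k) (b : k)) v := rfl
    rw [e, FiniteAdeleRing.algebraMap_apply]
    exact sub_mem (ha₁ v) (coe_algebraMap_mem (𝓞 k) k v b)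

end Assembly

end Summit.Ventures.HodgeRepro.Tier4.Line1

end
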